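import Literature.MathematicalPhysics.QuantumFieldTheory.Balaban1983to89.B9Eq382V3Letters

/-!
# `Balaban1983to89.B9Ineq385V3Concrete` — B9 p. 407 (3.85) «Using the bounds (3.73), (3.77), (3.83) and assuming that Theorem 3.3 holds
# for G(U), we get |(V(A)G(U)J)(b)| ≦ O(1)α₁e^{−(1/2)δ₀d(y,y′)}|J|» and «Thus Theorem 3.4 is proved, assuming that Theorems 3.1–3.3 hold»,
# FOR THE CONCRETE `V₃(A)` OF (3.82): the `V₃`-words of (3.85) and Theorem 3.4's `G`-clause, entry (3.42)₁, with the `V₃`-side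
# hypotheses of the devices `B9Ineq386CommSum.ineq385_op_sum` / `B9Ineq385VG.thm34_G_entry1_opForm` (`hV₃`, `hV₃′`, `h371`, `hV0`,
# `hV1`) DISCHARGED by the G-side twin (`B9Eq371GradLetters`, `B9Eq375GradLetters`, `B9Eq372RemLetters`, `B9Eq382V3Letters`) — fifth file

statement-level skeleton of published theorems with citation tags; proofs where landed; nothing here is a claim about the Yang–Mills mass gap

CITATION HEADER (lean-in-tree rule).  T. Bałaban, *Propagators for lattice gauge theories in a background field*, Commun. Math. Phys.
**99** (1985) 389–434 [Balaban1985BackgroundPropagators] (cell paper B9; held `paper:balaban1985-cmp99-background-propagators`, journal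
page = PDF page + 388), p. 407 [PDF 19] (read by this seat on the materialised page p0019, 2026-08-21).  THE PRINT (verbatim, p. 407):
«Let us denote the sum of these three operators by V(A). We can write (3.82) as Δ_a(U′U) = Δ_a(U) − V(A) = (I − V(A)G(U))Δ_a(U). (3.84)
Using the bounds (3.73), (3.77), (3.83) and assuming that Theorem 3.3 holds for G(U), we get |(V(A)G(U)J)(b)| ≦ O(1)α₁e^{−(1/2)δ₀d(y,y′)}
|J| for b ∈ Δ(y), supp J ⊂ Δ(y′). (3.85) […] hence V(A)G(U) is a small operator in supremum norm, and we have G(U′U) = G(U)(I −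
V(A)G(U))⁻¹ = Σ_{n=0}^∞ G(U)(V(A)G(U))ⁿ, (3.86) […] Thus Theorem 3.4 is proved, assuming that Theorems 3.1-3.3 hold.»  [4] = T. Bałaban,
*Propagators and renormalization transformations for lattice gauge theories. II*, Commun. Math. Phys. **96** (1984) 223–250
[Balaban1984PropagatorsII], (2.51)–(2.55) p. 232, Lemma 2.1 p. 234, (2.66) p. 234.  Cell `lit-balaban`, seat r06 (B9 fold owner) gen 10;
SKELETON rows **B9.Eq3.85** × **B9.Thm3.4** × B9.Eq3.82.

SIBLINGS REUSED BY NAME (imported; nothing restated): the devices `B9Ineq386CommSum.ineq385_op_sum` ((3.85) for a printed finite sum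
`V₃ = V⁰ + Σ_k V¹_k∇_k`), `B9Ineq385VG.exists_gExt_of_385`/`gExt_entry1_of_386`/`kappa385` ((3.86) and (3.42)₁ for `G(U′U)`),
`B9Eq386Neumann.eq384_sub`/`deltaA`/`vTotal`/`vThree`/`pTwo` ((3.82)–(3.84) regrouping), `B9Ineq366CPrime.hasMajorant_rate_mono`; the
G-side twin's `V₃Op` with `conj_V₃Op_eq_gradForm` (`hV₃`), `conj_V₃Op_eq_vThree` (`hV₃′`), `conj_lapDDLetter_prodCfg` (`h371`),
`hasMajorant_V₃_zero` (`hV0`), `hasMajorant_V₃_one` (`hV1`).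

WHAT THIS FILE PROVES (0 sorry; one def with body + theorems; no `def … : Prop`).
* `cV385 d α₁ C₀ M := (cV0 d α₁ C₀ + 28d(d+1))·M` — the (3.73) constant `c_V` of the concrete `V₃` fed to `κ₃₈₅` (`M = M₂(Σ‖b_i‖)e^{δd₀}`
  the real-coordinate/stencil factor; `28d(d+1)M = Σ_{k∈κ⊕κ} c_{1,k}`).
* **`ineq385_op_concreteV₃`** — (3.85) IN BLOCK-MAJORANT FORM FOR THE CONCRETE `V₃(A)` of (3.82): for a group-valued background `U`
  with (3.35) on plaquettes, (3.37) for `A` read blockwise on the stencils (files 1–4), lattice spacing `η = g.eta`, `η·α₁(Lʲη)⁻¹ ≦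
  1/4`, the stencil geometry, the geometry/rate hypotheses of the device (Lemma 2.1 of [4] as `ScaleTransfer`, (2.61) as `Ineq261`,
  `ρ + (α+β)δ₀ ≦ δ`), ABSTRACT `P₁`, `P₂` with their (3.77)/(3.83) majorants and Theorem 3.3's (3.42)₁,₂ for `G = G(U)` (`G ≺
  B₀(Lʲη)²e^{−δd}`, `∇_kG ≺ B₀Lʲη e^{−δd}` for the `2d` letters `∇_k = conj b (diffLetter k)`):
  `V(A)G(U) = vTotal (conj b V₃Op) P₁ P₂ * G ≺ κ₃₈₅(B₀, c_V, κ₁, κ₂, Λ, c₁)·α₁·e^{−ρd}` — the device with `hV₃`, `hV0`, `hV1` DISCHARGED.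
* **`thm34_G_entry1_concreteV₃`** — THEOREM 3.4, `G`-CLAUSE, ENTRY (3.42)₁, FOR THE CONCRETE PERTURBATION: with `Δ_a(U) = deltaA DsD Δp
  DRDs Qs a Q`, `DsD := conj b (lapDDLetter η⁻¹ U)`, `Δp := conj b (Δ′(U))`, the CONCRETE `DsD′ := conj b (lapDDLetter η⁻¹ (U′U))`,
  `Δp′ := conj b (Δ′(U′U))` and the abstract (3.76)/(3.80) data (`DRDs′ = DRDs − conj b V₂Op − P₁`, `Q′ = Q + F₂`, `Q*′ = Q* + F₂*`,
  `P₂ = pTwo …`), `G` a two-sided inverse of `Δ_a(U)` with (3.42)₁,₂, and `κ₃₈₅α₁c₁(α′) < 1`: THERE IS `G(U′U)`, a two-sided inverse of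
  `Δ_a(U′U) = deltaA DsD′ Δp′ DRDs′ Qs′ a Q′`, with `G(U′U) ≺ B₀c₁(α′)(1 − κ₃₈₅α₁c₁(α′))⁻¹(Lʲη)²e^{−(1−α′)ρd}` — pv-device
  `thm34_G_entry1_opForm`'s proof with `h371` := `conj_lapDDLetter_prodCfg`, `hV₃′` := `conj_V₃Op_eq_vThree`, (3.85) := the above.

HONEST SCOPE / NOT CLAIMED.  (i) `P₁(A)` ((3.76)–(3.77)), `P₂(A)` ((3.80)–(3.83)), the `DRD*`/averaging expansions `h376`/`h380`, the
inverse property of `G(U)` and Theorem 3.3's entries for `G(U)` remain HYPOTHESES (other rows/lanes); entries (3.42)₂,₃,₄ of the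
`G`-clause need the left/right-entry devices (`gExt_leftEntry_of_386`, `B9Ineq386RightEntry`, commutators `hComm`) — not here.  (ii) Group-
valued background, `η = g.eta`, (3.35) as `‖U(∂p) − 1‖ ≦ C₀L^{−2j}`, (3.37) blockwise at the output block's scale, stencil block distances
as hypotheses — as in file 4.  (iii) Real coordinates `(κ × S) × ι`, block map `((μ,x),i) ↦ y(x)`; rate bookkeeping as in the devices
(`ρ + (α+β)δ₀ ≦ δ`: the Theorem-3.3 rate `δ` of the inputs exceeds the output rate `ρ` by the located Lemma-2.1 losses).  Value = the
`V₃`-side of Theorem 3.4's proof closed for the concrete perturbation; NOT summit progress.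

RELATED IN THE TREE, NOT DUPLICATED (searched 2026-08-21: `lean search --decl 'concreteV₃|ineq385_op_concrete|thm34_G_entry1_concrete|cV385'` = ∅; the short name `cV`/`cV_nonneg` exists elsewhere (`B6DomainChange`), hence `cV385`):
`B9Ineq385VG.thm34_G_entry1_opForm` (single letter `V¹∇`) and `B9Ineq386CommSum.thm34_G_entries13_opForm_of_comm_sum` (finite sum, with
commutators) are the ABSTRACT devices; gen 9's `B9Ineq363Vprime.thm34_Gp_entries13_vPrime` is the G′-side analogue for the concrete
`V′(A)`.  This file is the G-side concrete instance for entry 1.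
-/

noncomputable section

namespace Literature.MathematicalPhysics.QuantumFieldTheory.Balaban1983to89.B9Ineq385V3Concrete

open NormedSpace Complex
open Literature.MathematicalPhysics.QuantumFieldTheory.Balaban1983to89
open Literature.MathematicalPhysics.QuantumFieldTheory.Balaban1983to89.B6RandomWalk (HasMajorant hasMajorant_mono hasMajorant_add
  Triangle254 Ineq261)
open Literature.MathematicalPhysics.QuantumFieldTheory.Balaban1983to89.B9Thm34Ext (toB6)
open Literature.MathematicalPhysics.QuantumFieldTheory.Balaban1983to89.B9Ineq347 (ScaleTransfer)
open Literature.MathematicalPhysics.QuantumFieldTheory.Balaban1983to89.B9Ineq366CPrime (hasMajorant_rate_mono)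
open Literature.MathematicalPhysics.QuantumFieldTheory.Balaban1983to89.B9Eq386Neumann (vTotal vThree pTwo deltaA eq384_sub)
open Literature.MathematicalPhysics.QuantumFieldTheory.Balaban1983to89.B9Ineq385VG (kappa385 kappa385_nonneg exists_gExt_of_385
  gExt_entry1_of_386)
open Literature.MathematicalPhysics.QuantumFieldTheory.Balaban1983to89.B9Ineq386CommSum (ineq385_op_sum)
open Literature.MathematicalPhysics.QuantumFieldTheory.Balaban1983to89.B9Eq39Adjoint
open Literature.MathematicalPhysics.QuantumFieldTheory.Balaban1983to89.B9Eq369Small (Through)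
open Literature.MathematicalPhysics.QuantumFieldTheory.Balaban1983to89.B9Eq372Locality (stBonds)
open Literature.MathematicalPhysics.QuantumFieldTheory.Balaban1983to89.B9Eq373V3 (kΔ)
open Literature.MathematicalPhysics.QuantumFieldTheory.Balaban1983to89.B9Eq382V3Operator (kΔ_nonneg)
open Literature.MathematicalPhysics.QuantumFieldTheory.Balaban1983to89.B9Eq352DivForm (tauF tauB)
open Literature.MathematicalPhysics.QuantumFieldTheory.Balaban1983to89.B9Eq352DivFormLetters
open Literature.MathematicalPhysics.QuantumFieldTheory.Balaban1983to89.B9Eq352GradLetters (diffLetter)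
open Literature.MathematicalPhysics.QuantumFieldTheory.Balaban1983to89.B9Eq371GradLetters (bT bU zeroLetter V1Letter)
open Literature.MathematicalPhysics.QuantumFieldTheory.Balaban1983to89.B9Eq375GradLetters (zeroLetter₂ V1Letter₂)
open Literature.MathematicalPhysics.QuantumFieldTheory.Balaban1983to89.B9Eq372RemLetters
open Literature.MathematicalPhysics.QuantumFieldTheory.Balaban1983to89.B9Eq382V3Letters

section Concrete

variable {𝔸 : Type*} [NormedRing 𝔸] [NormedAlgebra ℂ 𝔸] [CompleteSpace 𝔸] {ι : Type} [Fintype ι]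
variable (b : Module.Basis ι ℝ 𝔸) {S : Type} {κ : Type} [Fintype κ] [LinearOrder κ]
variable (T : κ → Equiv.Perm S) (U : κ → S → 𝔸ˣ)
variable {g : B9.Geometry} [Fintype g.Site] {Rr : ℝ} {H : Prop}

/-- THE (3.73) CONSTANT OF THE CONCRETE `V₃` AS FED TO `κ₃₈₅`: `c_V(d, α₁, C₀, M) = (c⁰_V(d, α₁, C₀) + 28d(d+1))·M` with `M =
M₂(Σ‖b_i‖)e^{δd₀}` — the zeroth-order constant `cV0` of file 4 plus `Σ_{k∈κ⊕κ} c_{1,k} = 2d·14(d+1)` (the device asks `Σ_k c_{1,k} ≦ c_V`).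
[cite: Balaban1985BackgroundPropagators, (3.73) p.405 + (3.85) p.407] -/
def cV385 (d : ℕ) (α₁ C₀ M : ℝ) : ℝ := (cV0 d α₁ C₀ + 28 * d * (d + 1)) * M

omit [Fintype ι] b [Fintype κ] [LinearOrder κ] T U [Fintype g.Site] [NormedAlgebra ℂ 𝔸] [CompleteSpace 𝔸] in
/-- `0 ≦ c⁰_V`. [cite: Balaban1985BackgroundPropagators, (3.73) p.405] -/
theorem cV0_nonneg (d : ℕ) {α₁ C₀ : ℝ} (hα₁ : 0 ≤ α₁) (hC₀ : 0 ≤ C₀) : 0 ≤ cV0 d α₁ C₀ := by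
  have hk : 0 ≤ kΔ α₁ C₀ := kΔ_nonneg hα₁ hC₀
  have hgr : 0 ≤ growth (1 / 4) := growth_nonneg (by norm_num)
  unfold cV0; positivity

omit [Fintype ι] b [Fintype κ] [LinearOrder κ] T U [Fintype g.Site] [NormedAlgebra ℂ 𝔸] [CompleteSpace 𝔸] in
/-- `0 ≦ c_V` for `M ≧ 0`. [cite: Balaban1985BackgroundPropagators, (3.73) p.405] -/
theorem cV385_nonneg (d : ℕ) {α₁ C₀ M : ℝ} (hα₁ : 0 ≤ α₁) (hC₀ : 0 ≤ C₀) (hM : 0 ≤ M) : 0 ≤ cV385 d α₁ C₀ M := by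
  have := cV0_nonneg d hα₁ hC₀
  unfold cV385; positivity

/-- **(3.85) IN BLOCK-MAJORANT FORM FOR THE CONCRETE `V₃(A)` OF (3.82)** — `B9Ineq386CommSum.ineq385_op_sum` with its `V₃`-side
hypotheses DISCHARGED by the G-side twin: `hV₃` := `conj_V₃Op_eq_gradForm` (the `2d` letters `k ∈ κ ⊕ κ`), `hV0` :=
`hasMajorant_V₃_zero`, `hV1` := `hasMajorant_V₃_one` (`c_{1,k} = 14(d+1)M`).  Remaining inputs: group-valued `U` with (3.35) on the
plaquettes through each bond, (3.37) for `A` blockwise on the stencils, `η = g.eta` with `η·α₁(Lʲη)⁻¹ ≦ 1/4`, the stencil geometry,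
the device's geometry ((2.54), (2.61) of [4], Lemma 2.1 as `ScaleTransfer`, `ρ + (α+β)δ₀ ≦ δ`), abstract `P₁`, `P₂` with their
(3.77)/(3.83)-majorants, Theorem 3.3's (3.42)₁ for `G = G(U)` and (3.42)₂ in the form `∇_kG ≺ B₀Lʲη e^{−δd}` for each letter.
CONCLUSION: `V(A)G(U) ≺ κ₃₈₅·α₁·e^{−ρd}`.
[cite: Balaban1985BackgroundPropagators, (3.84)–(3.85) p.407 + (3.73) p.405 + (3.82) p.407; Balaban1984PropagatorsII, (2.51)–(2.55) p.232 + Lemma 2.1 p.234] -/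
theorem ineq385_op_concreteV₃ (blk : S → g.Site) (d : ℕ) (δ₀ δ α β ρ Λ B₀ κ₁ κ₂ α₁ C₀ d₀ M₂ : ℝ)
    (hB₀ : 0 ≤ B₀) (hκ₁ : 0 ≤ κ₁) (hκ₂ : 0 ≤ κ₂) (hα₁ : 0 ≤ α₁) (hC₀ : 0 ≤ C₀) (hΛ : 0 ≤ Λ) (hρ : 0 ≤ ρ)
    (hα : 0 ≤ α) (hβ : 0 ≤ β) (hδ₀ : 0 ≤ δ₀) (hδ : 0 ≤ δ) (hM₂ : 0 ≤ M₂) (hr : ρ + (α + β) * δ₀ ≤ δ)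
    (hdnn : ∀ a a' : g.Site, 0 ≤ g.dist a a') (htri : Triangle254 (toB6 g Rr H)) (hlen : ∀ y : g.Site, 0 < g.len y)
    (h261 : Ineq261 d (toB6 g Rr H) δ₀ β)
    (hT1 : ScaleTransfer g δ₀ α Λ (fun a => g.len a)) (hT2 : ScaleTransfer g δ₀ α Λ (fun a => g.len a ^ 2))
    (hrepr : ∀ (v : 𝔸) (i : ι), |b.repr v i| ≤ M₂ * ‖v‖) (hη : 0 < g.eta) (hL : 1 ≤ g.L) (A : κ → S → 𝔸)
    (hsmall : ∀ y : g.Site, g.eta * (α₁ * (g.len y)⁻¹) ≤ 1 / 4)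
    (hU1 : ∀ m z, ‖((U m z : 𝔸ˣ) : 𝔸)‖ ≤ 1 ∧ ‖(((U m z)⁻¹ : 𝔸ˣ) : 𝔸)‖ ≤ 1)
    (h337B : ∀ ν k x, ‖((g.eta : ℂ)⁻¹) • covDstar T U ν (A k) x‖ ≤ α₁ * (g.len (blk x) ^ 2)⁻¹)
    (h337F : ∀ μ ν x, ‖((g.eta : ℂ)⁻¹) • covD T U μ (A ν) x‖ ≤ α₁ * (g.len (blk x) ^ 2)⁻¹)
    (h337B' : ∀ μ ν x, ‖((g.eta : ℂ)⁻¹) • covDstar T U ν (A ν) (T μ x)‖ ≤ α₁ * (g.len (blk x) ^ 2)⁻¹)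
    (hA : ∀ k x, ‖A k x‖ ≤ α₁ * (g.len (blk x))⁻¹) (hAτB : ∀ ν k x, ‖tauB T U ν (A k) x‖ ≤ α₁ * (g.len (blk x))⁻¹)
    (hAτF : ∀ μ k x, ‖tauF T U μ (A k) x‖ ≤ α₁ * (g.len (blk x))⁻¹)
    (hAst : ∀ μ x m z, (m, z) ∈ stBonds T μ x → ‖A m z‖ ≤ α₁ * (g.len (blk x))⁻¹)
    (hAloc : ∀ μ x m z, (m, z) ∈ B9Eq375Locality.locBondsA T μ x → ‖A m z‖ ≤ α₁ * (g.len (blk x))⁻¹)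
    (hdAst : ∀ μ x m n y, Through T μ x m n y →
      ‖covD T U m (A n) y‖ ≤ g.eta * (α₁ * ((g.len (blk x))⁻¹) ^ 2) ∧
        ‖covD T U n (A m) y‖ ≤ g.eta * (α₁ * ((g.len (blk x))⁻¹) ^ 2))
    (h35 : ∀ μ x m n y, Through T μ x m n y → ‖(plaqU T U m n y : 𝔸) - 1‖ ≤ C₀ * ((g.L ^ g.scale (blk x))⁻¹) ^ 2)
    (hd₀B : ∀ μ x, g.dist (blk x) (blk ((T μ).symm x)) ≤ d₀) (hd₀F : ∀ μ x, g.dist (blk x) (blk (T μ x)) ≤ d₀)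
    (hd₀FB : ∀ μ ν x, g.dist (blk x) (blk ((T ν).symm (T μ x))) ≤ d₀)
    (hd₀st : ∀ μ x (q : κ × S), q ∈ stBonds T μ x → g.dist (blk x) (blk q.2) ≤ d₀)
    (hd₀loc : ∀ μ x (q : κ × S), q ∈ B9Eq375Locality.locBondsA' T μ x → g.dist (blk x) (blk q.2) ≤ d₀)
    (hd₀0 : ∀ y : g.Site, g.dist y y ≤ d₀)
    {G P₁ P₂ : Module.End ℝ ((κ × S) × ι → ℝ)}
    (hP₁ : HasMajorant (g := toB6 g Rr H) (fun q : (κ × S) × ι => blk q.1.2) P₁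
      (fun a a' => κ₁ * α₁ * (g.len a ^ 2)⁻¹ * Real.exp (-(δ * g.dist a a'))))
    (hP₂ : HasMajorant (g := toB6 g Rr H) (fun q : (κ × S) × ι => blk q.1.2) P₂
      (fun a a' => κ₂ * α₁ * (g.len a ^ 2)⁻¹ * Real.exp (-(δ * g.dist a a'))))
    (hG : HasMajorant (g := toB6 g Rr H) (fun q : (κ × S) × ι => blk q.1.2) G
      (fun a a' => B₀ * g.len a ^ 2 * Real.exp (-(δ * g.dist a a'))))
    (hDG : ∀ k : κ ⊕ κ, HasMajorant (g := toB6 g Rr H) (fun q : (κ × S) × ι => blk q.1.2)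
      (conj b (diffLetter (bT T) (bU U) ((g.eta : ℂ)⁻¹) k) * G) (fun a a' => B₀ * g.len a * Real.exp (-(δ * g.dist a a')))) :
    HasMajorant (g := toB6 g Rr H) (fun q : (κ × S) × ι => blk q.1.2) (vTotal (conj b (V₃Op T U g.eta A)) P₁ P₂ * G)
      (fun a a' => kappa385 B₀ (cV385 (Fintype.card κ) α₁ C₀ (M₂ * (∑ i, ‖b i‖) * Real.exp (δ * d₀))) κ₁ κ₂ Λ (B6.c1 d δ₀ β) *
        α₁ * Real.exp (-(ρ * g.dist a a'))) := by
  have hbsum : 0 ≤ ∑ i, ‖b i‖ := Finset.sum_nonneg fun i _ => norm_nonneg _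
  have hM : 0 ≤ M₂ * (∑ i, ‖b i‖) * Real.exp (δ * d₀) := by positivity
  have hcV0 := cV0_nonneg (Fintype.card κ) hα₁ hC₀
  have hcV := cV385_nonneg (Fintype.card κ) hα₁ hC₀ hM
  -- the discharged `V₃`-side inputs
  have hV₃ := conj_V₃Op_eq_gradForm T U b g.eta A
  have hV0 := hasMajorant_V₃_zero (Rr := Rr) (H := H) b T U blk hη hL A C₀ d₀ δ M₂ α₁ hα₁ hC₀ hδ hM₂ hrepr hlen hsmall hU1
    h337B h337F h337B' hAst hAloc hdAst h35 hd₀B hd₀F hd₀FB hd₀st hd₀loc hd₀0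
  have hV1 := hasMajorant_V₃_one (Rr := Rr) (H := H) b T U blk A d₀ δ M₂ α₁ hα₁ hδ hM₂ hrepr hlen hA hAτB hAτF hU1 hd₀B hd₀F hd₀0
  have hV0' : HasMajorant (g := toB6 g Rr H) (fun q : (κ × S) × ι => blk q.1.2)
      (conj b (zeroLetter T U ((g.eta : ℂ)⁻¹) A + F₁Letter T U g.eta A)
        - conj b (dPrimeLetter T (prodCfg U g.eta A) g.eta - dPrimeLetter T U g.eta)
        + conj b (zeroLetter₂ T U ((g.eta : ℂ)⁻¹) A + F₂Letter T U g.eta A))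
      (fun a a' => cV385 (Fintype.card κ) α₁ C₀ (M₂ * (∑ i, ‖b i‖) * Real.exp (δ * d₀)) * α₁ * (g.len a ^ 2)⁻¹ *
        Real.exp (-(δ * g.dist a a'))) := by
    refine hasMajorant_mono (g := toB6 g Rr H) _ hV0 fun y y' => ?_
    have h0 : 0 ≤ 28 * (Fintype.card κ : ℝ) * (Fintype.card κ + 1) * (M₂ * (∑ i, ‖b i‖) * Real.exp (δ * d₀)) * α₁ *
        (g.len y ^ 2)⁻¹ * Real.exp (-(δ * g.dist y y')) := by positivity
    have e : cV385 (Fintype.card κ) α₁ C₀ (M₂ * (∑ i, ‖b i‖) * Real.exp (δ * d₀)) * α₁ * (g.len y ^ 2)⁻¹ *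
          Real.exp (-(δ * g.dist y y'))
        = cV0 (Fintype.card κ) α₁ C₀ * M₂ * (∑ i, ‖b i‖) * Real.exp (δ * d₀) * α₁ * (g.len y ^ 2)⁻¹ *
            Real.exp (-(δ * g.dist y y'))
          + 28 * (Fintype.card κ : ℝ) * (Fintype.card κ + 1) * (M₂ * (∑ i, ‖b i‖) * Real.exp (δ * d₀)) * α₁ *
            (g.len y ^ 2)⁻¹ * Real.exp (-(δ * g.dist y y')) := by
      unfold cV385; ring
    rw [e]
    linarith
  have hsum : ∑ _k ∈ (Finset.univ : Finset (κ ⊕ κ)),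
      14 * ((Fintype.card κ : ℝ) + 1) * M₂ * (∑ i, ‖b i‖) * Real.exp (δ * d₀)
        ≤ cV385 (Fintype.card κ) α₁ C₀ (M₂ * (∑ i, ‖b i‖) * Real.exp (δ * d₀)) := by
    rw [Finset.sum_const, Finset.card_univ, Fintype.card_sum, nsmul_eq_mul, Nat.cast_add]
    have h0 : 0 ≤ cV0 (Fintype.card κ) α₁ C₀ * (M₂ * (∑ i, ‖b i‖) * Real.exp (δ * d₀)) := mul_nonneg hcV0 hM
    have e : cV385 (Fintype.card κ) α₁ C₀ (M₂ * (∑ i, ‖b i‖) * Real.exp (δ * d₀))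
        = cV0 (Fintype.card κ) α₁ C₀ * (M₂ * (∑ i, ‖b i‖) * Real.exp (δ * d₀))
          + ((Fintype.card κ : ℝ) + Fintype.card κ) * (14 * ((Fintype.card κ : ℝ) + 1) * M₂ * (∑ i, ‖b i‖) *
            Real.exp (δ * d₀)) := by
      unfold cV385; ring
    rw [e]
    linarith
  exact ineq385_op_sum (R := Rr) (H := H) (fun q : (κ × S) × ι => blk q.1.2) d Finset.univ δ₀ δ α β ρ Λ B₀
    (cV385 (Fintype.card κ) α₁ C₀ (M₂ * (∑ i, ‖b i‖) * Real.exp (δ * d₀))) κ₁ κ₂ α₁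
    (fun _ => 14 * ((Fintype.card κ : ℝ) + 1) * M₂ * (∑ i, ‖b i‖) * Real.exp (δ * d₀))
    hB₀ hcV hκ₁ hκ₂ hα₁ hΛ hρ hα hβ hδ₀ hr (fun k _ => by positivity) hsum hdnn htri hlen h261 hT1 hT2
    (V1 := fun k => conj b (V1Letter T U A k) + conj b (V1Letter₂ T U A k))
    (D := fun k => conj b (diffLetter (bT T) (bU U) ((g.eta : ℂ)⁻¹) k))
    hV₃ hV0' (fun k _ => hV1 k) hP₁ hP₂ hG (fun k _ => hDG k)

/-- **THEOREM 3.4, `G`-CLAUSE, ENTRY (3.42)₁, FOR THE CONCRETE PERTURBATION OF (3.82)** («Thus Theorem 3.4 is proved, assuming that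
Theorems 3.1–3.3 hold», for the first inequality of `G(U′U)`): the device `B9Ineq385VG.thm34_G_entry1_opForm`'s assembly with
`h371` := `conj_lapDDLetter_prodCfg` (file 3), `hV₃′` := `conj_V₃Op_eq_vThree` (file 4) and (3.85) := `ineq385_op_concreteV₃`; the
(3.76)/(3.80) expansions (`DRD*`, averaging: `P₁`, `F₂`, `F₂*`, `P₂ = pTwo …`), the inverse property `Δ_a(U)G(U) = G(U)Δ_a(U) = 1`
((3.27)), Theorem 3.3's entries for `G(U)` and the smallness `κ₃₈₅α₁c₁(α′) < 1` («α₁ sufficiently small») stay hypotheses.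
CONCLUSION: a two-sided inverse `G(U′U)` of `Δ_a(U′U) = deltaA (conj b D*D_{U′U}) (conj b Δ′(U′U)) DRDs′ Qs′ a Q′` with
`G(U′U) ≺ B₀c₁(α′)(1 − κ₃₈₅α₁c₁(α′))⁻¹(Lʲη)²e^{−(1−α′)ρ d(y,y′)}` (finite lattice: `[Fintype S]`, as in the device's Neumann-series
existence `exists_gExt_of_385`).
[cite: Balaban1985BackgroundPropagators, Thm 3.4 p.400 + (3.82)–(3.86) p.407 + (3.27) p.395 + (3.42) p.397; Balaban1984PropagatorsII, (2.66) p.234 + Lemma 2.1 p.234] -/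
theorem thm34_G_entry1_concreteV₃ [Fintype S] [DecidableEq S] [DecidableEq ι] (blk : S → g.Site) (d : ℕ) (δ₀ δ α β ρ α' Λ B₀ κ₁ κ₂ α₁ C₀ d₀ M₂ : ℝ)
    (hB₀ : 0 ≤ B₀) (hκ₁ : 0 ≤ κ₁) (hκ₂ : 0 ≤ κ₂) (hα₁ : 0 ≤ α₁) (hC₀ : 0 ≤ C₀) (hΛ : 0 ≤ Λ) (hρ : 0 ≤ ρ)
    (hα : 0 ≤ α) (hβ : 0 ≤ β) (hδ₀ : 0 ≤ δ₀) (hδ : 0 ≤ δ) (hM₂ : 0 ≤ M₂) (hr : ρ + (α + β) * δ₀ ≤ δ) (hα' : α' ≤ 1)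
    (hα'ρ : 0 ≤ (1 - α') * ρ)
    (hdnn : ∀ a a' : g.Site, 0 ≤ g.dist a a') (htri : Triangle254 (toB6 g Rr H)) (hrefl : ∀ y : g.Site, g.dist y y = 0)
    (hlen : ∀ y : g.Site, 0 < g.len y) (h261 : Ineq261 d (toB6 g Rr H) δ₀ β) (h261' : Ineq261 d (toB6 g Rr H) ρ α')
    (hT1 : ScaleTransfer g δ₀ α Λ (fun a => g.len a)) (hT2 : ScaleTransfer g δ₀ α Λ (fun a => g.len a ^ 2))
    (hsmall385 : kappa385 B₀ (cV385 (Fintype.card κ) α₁ C₀ (M₂ * (∑ i, ‖b i‖) * Real.exp (δ * d₀))) κ₁ κ₂ Λ (B6.c1 d δ₀ β) *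
      α₁ * B6.c1 d ρ α' < 1)
    (hrepr : ∀ (v : 𝔸) (i : ι), |b.repr v i| ≤ M₂ * ‖v‖) (hη : 0 < g.eta) (hL : 1 ≤ g.L) (A : κ → S → 𝔸)
    (hsmall : ∀ y : g.Site, g.eta * (α₁ * (g.len y)⁻¹) ≤ 1 / 4)
    (hU1 : ∀ m z, ‖((U m z : 𝔸ˣ) : 𝔸)‖ ≤ 1 ∧ ‖(((U m z)⁻¹ : 𝔸ˣ) : 𝔸)‖ ≤ 1)
    (h337B : ∀ ν k x, ‖((g.eta : ℂ)⁻¹) • covDstar T U ν (A k) x‖ ≤ α₁ * (g.len (blk x) ^ 2)⁻¹)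
    (h337F : ∀ μ ν x, ‖((g.eta : ℂ)⁻¹) • covD T U μ (A ν) x‖ ≤ α₁ * (g.len (blk x) ^ 2)⁻¹)
    (h337B' : ∀ μ ν x, ‖((g.eta : ℂ)⁻¹) • covDstar T U ν (A ν) (T μ x)‖ ≤ α₁ * (g.len (blk x) ^ 2)⁻¹)
    (hA : ∀ k x, ‖A k x‖ ≤ α₁ * (g.len (blk x))⁻¹) (hAτB : ∀ ν k x, ‖tauB T U ν (A k) x‖ ≤ α₁ * (g.len (blk x))⁻¹)
    (hAτF : ∀ μ k x, ‖tauF T U μ (A k) x‖ ≤ α₁ * (g.len (blk x))⁻¹)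
    (hAst : ∀ μ x m z, (m, z) ∈ stBonds T μ x → ‖A m z‖ ≤ α₁ * (g.len (blk x))⁻¹)
    (hAloc : ∀ μ x m z, (m, z) ∈ B9Eq375Locality.locBondsA T μ x → ‖A m z‖ ≤ α₁ * (g.len (blk x))⁻¹)
    (hdAst : ∀ μ x m n y, Through T μ x m n y →
      ‖covD T U m (A n) y‖ ≤ g.eta * (α₁ * ((g.len (blk x))⁻¹) ^ 2) ∧
        ‖covD T U n (A m) y‖ ≤ g.eta * (α₁ * ((g.len (blk x))⁻¹) ^ 2))
    (h35 : ∀ μ x m n y, Through T μ x m n y → ‖(plaqU T U m n y : 𝔸) - 1‖ ≤ C₀ * ((g.L ^ g.scale (blk x))⁻¹) ^ 2)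
    (hd₀B : ∀ μ x, g.dist (blk x) (blk ((T μ).symm x)) ≤ d₀) (hd₀F : ∀ μ x, g.dist (blk x) (blk (T μ x)) ≤ d₀)
    (hd₀FB : ∀ μ ν x, g.dist (blk x) (blk ((T ν).symm (T μ x))) ≤ d₀)
    (hd₀st : ∀ μ x (q : κ × S), q ∈ stBonds T μ x → g.dist (blk x) (blk q.2) ≤ d₀)
    (hd₀loc : ∀ μ x (q : κ × S), q ∈ B9Eq375Locality.locBondsA' T μ x → g.dist (blk x) (blk q.2) ≤ d₀)
    (hd₀0 : ∀ y : g.Site, g.dist y y ≤ d₀)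
    {G P₁ P₂ DRDs DRDs' Qs Qs' Q Q' a F₂ F₂s : Module.End ℝ ((κ × S) × ι → ℝ)}
    (h376 : DRDs' = DRDs - conj b (V₂Op T U g.eta A) - P₁) (h380 : Q' = Q + F₂) (h380s : Qs' = Qs + F₂s)
    (hP₂def : P₂ = pTwo Qs Q F₂ F₂s a)
    (hΔG : deltaA (conj b (lapDDLetter T ((g.eta : ℂ)⁻¹) U)) (conj b (dPrimeLetter T U g.eta)) DRDs Qs a Q * G = 1)
    (hGΔ : G * deltaA (conj b (lapDDLetter T ((g.eta : ℂ)⁻¹) U)) (conj b (dPrimeLetter T U g.eta)) DRDs Qs a Q = 1)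
    (hP₁ : HasMajorant (g := toB6 g Rr H) (fun q : (κ × S) × ι => blk q.1.2) P₁
      (fun a a' => κ₁ * α₁ * (g.len a ^ 2)⁻¹ * Real.exp (-(δ * g.dist a a'))))
    (hP₂ : HasMajorant (g := toB6 g Rr H) (fun q : (κ × S) × ι => blk q.1.2) P₂
      (fun a a' => κ₂ * α₁ * (g.len a ^ 2)⁻¹ * Real.exp (-(δ * g.dist a a'))))
    (hG : HasMajorant (g := toB6 g Rr H) (fun q : (κ × S) × ι => blk q.1.2) G
      (fun a a' => B₀ * g.len a ^ 2 * Real.exp (-(δ * g.dist a a'))))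
    (hDG : ∀ k : κ ⊕ κ, HasMajorant (g := toB6 g Rr H) (fun q : (κ × S) × ι => blk q.1.2)
      (conj b (diffLetter (bT T) (bU U) ((g.eta : ℂ)⁻¹) k) * G) (fun a a' => B₀ * g.len a * Real.exp (-(δ * g.dist a a')))) :
    ∃ GExt : Module.End ℝ ((κ × S) × ι → ℝ),
      deltaA (conj b (lapDDLetter T ((g.eta : ℂ)⁻¹) (prodCfg U g.eta A)))
          (conj b (dPrimeLetter T (prodCfg U g.eta A) g.eta)) DRDs' Qs' a Q' * GExt = 1 ∧
      GExt * deltaA (conj b (lapDDLetter T ((g.eta : ℂ)⁻¹) (prodCfg U g.eta A)))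
          (conj b (dPrimeLetter T (prodCfg U g.eta A) g.eta)) DRDs' Qs' a Q' = 1 ∧
      HasMajorant (g := toB6 g Rr H) (fun q : (κ × S) × ι => blk q.1.2) GExt
        (fun a a' => B₀ * B6.c1 d ρ α' *
          (1 - kappa385 B₀ (cV385 (Fintype.card κ) α₁ C₀ (M₂ * (∑ i, ‖b i‖) * Real.exp (δ * d₀))) κ₁ κ₂ Λ (B6.c1 d δ₀ β) *
            α₁ * B6.c1 d ρ α')⁻¹ * g.len a ^ 2 * Real.exp (-((1 - α') * ρ * g.dist a a'))) := by
  have hbsum : 0 ≤ ∑ i, ‖b i‖ := Finset.sum_nonneg fun i _ => norm_nonneg _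
  have hM : 0 ≤ M₂ * (∑ i, ‖b i‖) * Real.exp (δ * d₀) := by positivity
  have hcV := cV385_nonneg (Fintype.card κ) hα₁ hC₀ hM
  -- (3.85) for the concrete V₃
  have h385 := ineq385_op_concreteV₃ (Rr := Rr) (H := H) b T U blk d δ₀ δ α β ρ Λ B₀ κ₁ κ₂ α₁ C₀ d₀ M₂ hB₀ hκ₁ hκ₂ hα₁ hC₀ hΛ
    hρ hα hβ hδ₀ hδ hM₂ hr hdnn htri hlen h261 hT1 hT2 hrepr hη hL A hsmall hU1 h337B h337F h337B' hA hAτB hAτF hAst hAloc hdAst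
    h35 hd₀B hd₀F hd₀FB hd₀st hd₀loc hd₀0 hP₁ hP₂ hG hDG
  have hθ : 0 ≤ kappa385 B₀ (cV385 (Fintype.card κ) α₁ C₀ (M₂ * (∑ i, ‖b i‖) * Real.exp (δ * d₀))) κ₁ κ₂ Λ (B6.c1 d δ₀ β) * α₁ :=
    mul_nonneg (kappa385_nonneg hB₀ hcV hκ₁ hκ₂ hΛ (B6RandomWalk.c1_nonneg d δ₀ β)) hα₁
  -- (3.71) and the `V₃` regrouping of (3.82), discharged
  have h371 := conj_lapDDLetter_prodCfg (b := b) (T := T) (U := U) hη.ne' A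
  -- (3.84): Δ_a(U′U) = Δ_a(U) − V(A)
  have h384 : deltaA (conj b (lapDDLetter T ((g.eta : ℂ)⁻¹) (prodCfg U g.eta A)))
        (conj b (dPrimeLetter T (prodCfg U g.eta A) g.eta)) DRDs' Qs' a Q'
      = deltaA (conj b (lapDDLetter T ((g.eta : ℂ)⁻¹) U)) (conj b (dPrimeLetter T U g.eta)) DRDs Qs a Q
        - vTotal (conj b (V₃Op T U g.eta A)) P₁ P₂ := by
    rw [eq384_sub _ _ (conj b (dPrimeLetter T U g.eta)) (conj b (dPrimeLetter T (prodCfg U g.eta A) g.eta)) DRDs DRDs' Qs Qs'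
      Q Q' a (conj b (V₁Op T U g.eta A)) (conj b (V₂Op T U g.eta A)) P₁ F₂ F₂s h371 h376 h380 h380s,
      ← conj_V₃Op_eq_vThree, hP₂def]
  -- (3.86): existence with the resolvent identities and the inverse property
  obtain ⟨GExt, -, h386, hL', hR'⟩ := exists_gExt_of_385 (R := Rr) (H := H) (fun q : (κ × S) × ι => blk q.1.2) d ρ α' _ hθ
    hα'ρ hdnn h261' hsmall385 _ G (vTotal (conj b (V₃Op T U g.eta A)) P₁ P₂) hΔG hGΔ h385
  refine ⟨GExt, ?_, ?_, ?_⟩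
  · rw [h384]; exact hL'
  · rw [h384]; exact hR'
  · have hρδ : ρ ≤ δ := by
      have : 0 ≤ (α + β) * δ₀ := by positivity
      linarith
    have hGρ := hasMajorant_rate_mono (R := Rr) (H := H) (fun q : (κ × S) × ι => blk q.1.2) B₀ (fun a => g.len a ^ 2) hB₀
      (fun a => sq_nonneg _) hρδ hdnn hG
    exact gExt_entry1_of_386 (R := Rr) (H := H) (fun q : (κ × S) × ι => blk q.1.2) d ρ α' _ B₀ (fun a => g.len a ^ 2) hB₀
      (fun a => sq_nonneg _) hθ hρ hα' hα'ρ htri hrefl hdnn h261' hsmall385 hGρ h385 h386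

end Concrete

end Literature.MathematicalPhysics.QuantumFieldTheory.Balaban1983to89.B9Ineq385V3Concrete
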